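import Summits.BirchSwinnertonDyer.Rank1Residual.X2.RankOneHeegnerClass
import Literature.NumberTheory.EllipticCurves.GlobalMinimalModel
import HarnessLib

/-!
# Class X2, rank `1` (sub-cell X2c): transport item (e) PROVED — the scaling between the twisted
# equation and a globally minimal model of the twist is a `p`-adic unit (cell `b2b-bsdres`, unit `b2b-bsdres-eisenstein-p2`, gen 2)

HONEST FRAMING (run/shared/lean/b2b/bsd-rank1-residual/, verbatim in every file): the goal of the
cell is to DELETE the COMBINATION-SHAPED residual classes of the Birch–Swinnerton-Dyer formula for
ALL analytic-rank `≤ 1` elliptic curves over `ℚ` — "full BSD formula for every rank `≤ 1` curve in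
class `C`" assembled STRICTLY from published theorems — so that the rank-`≤ 1` remainder becomes
exactly the CONSTRUCTION-SHAPED classes, which are TYPED (missing-input `Prop`s), NOT attempted.
This is not "finishing BSD". Research routes; no claim beyond stated classes; no label changes.

THEOREMS ONLY. `X2/RankOneHeegnerClass.lean` (p201473) takes a transport package
`X2.TwistTransportPackage` with TWO per-pair values for every globally minimal model
`Wd = Cd • E^{(d_K)}` of the twist: (d) `ord_p ∏_ℓ c_ℓ(Wd) = ord_p ∏_ℓ c_ℓ(W)` and (e)
`ord_p u(Cd) = 0` (items (d), (e) of the X11b lane's list, Jetchev–Skinner–Wan 2017 (eq:tamK)).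
This file PROVES (e): at an odd prime `p ∤ d` of multiplicative reduction for the globally minimal
`W`, the twisted equation `W^{(d)}` (Silverman X.5.4's model) is `v`-integral with `v(c₄) = 0`,
hence MINIMAL at the place `v ∣ p` (`isMinimalAt_quadraticTwist_of_mult`, the computation inside
gen 1's `hasMultiplicativeReductionAtPrime_of_smul_eq_quadraticTwist`, exported); two `v`-minimal
equations differ by a change of variables with `v(u) = 0` (Silverman VII.1.3(b):
`valuation_u_eq_one_of_isMinimalAt_smul`, the local form of the tree's
`IsGloballyMinimal.valuation_u_le_one`); and `v(u) = 0` at the place over `p` is `ord_p u = 0`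
(`padicValRat_eq_zero_of_valuation_eq_one`). Consequence: `twistTransportPackage_of_tamagawaValue` —
the package follows from the Tamagawa value (d) ALONE, so the class-level theorems of
`RankOneHeegnerClass.lean` / `RankOneChain.lean` need only (d) (routine too — `c_ℓ` agree at the
split `ℓ ∣ N`, lie in `{1,2,4}` at the odd `ℓ ∣ d_K` — but about local Tamagawa numbers, left to the
X11b lane which lists it).

References: [SilvermanAEC2009] VII.1 Prop. 1.3(b), VII.5 Prop. 5.1(b), X.5 Cor. 5.4 / Ex. 10.22;
[JetchevSkinnerWan2017] §7.4.1 (eq:tamK).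
-/

set_option autoImplicit false

noncomputable section

open scoped Classical MatrixGroups ModularForm

open CongruenceSubgroup WeierstrassCurve NumberField IsDedekindDomain
  IsDedekindDomain.HeightOneSpectrum Rat.HeightOneSpectrum Literature.NumberTheory.EllipticCurves
  Literature.NumberTheory.EllipticCurves.ModularForms
  Literature.NumberTheory.EllipticCurves.Rank1Residual

namespace Summit.BirchSwinnertonDyer.Rank1Residual.X2

/-! ### Two `v`-minimal equations differ by a `v`-unit scaling -/

/-- **Silverman VII.1.3(b) at one place:** if `W` and `C • W` are both minimal at the finite place
`v` of `ℚ` (Weierstrass equations of an elliptic curve, `Δ ≠ 0`), then `v(u) = 1` multiplicatively,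
i.e. `ord_v u(C) = 0`. Local form of `IsGloballyMinimal.valuation_u_le_one` (same proof: `u`, `u⁻¹`
lift to `𝒪_v`). [cite: SilvermanAEC2009, VII.1 Prop. 1.3(b) (PDF p. 165)] -/
theorem valuation_u_eq_one_of_isMinimalAt_smul (W : WeierstrassCurve ℚ) [W.IsElliptic]
    (C : VariableChange ℚ) (v : HeightOneSpectrum (𝓞 ℚ)) (hW : W.IsMinimalAt v)
    (hCW : (C • W).IsMinimalAt v) : v.valuation ℚ (C.u : ℚ) = 1 := by
  haveI : IsMinimal (v.adicCompletionIntegers ℚ) (W.baseChange (v.adicCompletion ℚ)) := hW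
  haveI : IsMinimal (v.adicCompletionIntegers ℚ)
      ((C.baseChange (v.adicCompletion ℚ)) • (W.baseChange (v.adicCompletion ℚ))) := by
    rw [VariableChange.baseChange, baseChange, map_variableChange]
    exact hCW
  have hΔ : (W.baseChange (v.adicCompletion ℚ)).Δ ≠ 0 := by
    rw [baseChange, map_Δ]
    exact (map_ne_zero _).mpr W.isUnit_Δ.ne_zero
  obtain ⟨⟨a, ha⟩, ⟨b, hb⟩⟩ := exists_algebraMap_eq_u_of_isMinimal (v.adicCompletionIntegers ℚ)
    (W.baseChange (v.adicCompletion ℚ)) (C.baseChange (v.adicCompletion ℚ)) hΔ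
  rw [VariableChange.baseChange] at ha hb
  rw [VariableChange.map_u, Units.coe_map, MonoidHom.coe_coe] at ha
  rw [VariableChange.map_u, Units.coe_map_inv, MonoidHom.coe_coe] at hb
  have h1 : v.valuation ℚ (C.u : ℚ) ≤ 1 := by
    have h := a.2
    rw [HeightOneSpectrum.mem_adicCompletionIntegers, ← ValuationSubring.algebraMap_apply, ha] at h
    rwa [← HeightOneSpectrum.valuedAdicCompletion_eq_valuation']
  have h2 : v.valuation ℚ (↑C.u⁻¹ : ℚ) ≤ 1 := by
    have h := b.2
    rw [HeightOneSpectrum.mem_adicCompletionIntegers, ← ValuationSubring.algebraMap_apply, hb] at h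
    rwa [← HeightOneSpectrum.valuedAdicCompletion_eq_valuation']
  have hu0 : v.valuation ℚ (C.u : ℚ) ≠ 0 :=
    (Valuation.ne_zero_iff _).mpr (Units.ne_zero C.u)
  rw [Units.val_inv_eq_inv_val, map_inv₀, inv_le_one₀ (zero_lt_iff.mpr hu0)] at h2
  exact le_antisymm h1 h2

/-- `v(x) = 1` at the place of `ℚ` over `p` means `ord_p x = 0` (`x ≠ 0`), through Mathlib's
`Rat.HeightOneSpectrum.valuation_equiv_padicValuation`. [folklore] -/
theorem padicValRat_eq_zero_of_valuation_eq_one (v : HeightOneSpectrum (𝓞 ℚ)) (p : ℕ)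
    [Fact p.Prime] (hvp : ((primesEquiv v : Nat.Primes) : ℕ) = p) {x : ℚ} (hx : x ≠ 0)
    (h : v.valuation ℚ x = 1) : padicValRat p x = 0 := by
  subst hvp
  rw [(valuation_equiv_padicValuation v).eq_one_iff_eq_one] at h
  change Rat.padicValuation (primesEquiv v) x = 1 at h
  simp only [Rat.padicValuation, Valuation.coe_mk, MonoidWithZeroHom.coe_mk, ZeroHom.coe_mk, hx,
    if_false] at h
  have h' : WithZero.exp (-padicValRat (primesEquiv v : ℕ) x) = WithZero.exp 0 := by
    rw [h, WithZero.exp_zero]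
  have := WithZero.exp_injective h'
  linarith

/-! ### The twisted equation is minimal at an odd multiplicative prime `p ∤ d` -/

/-- **`W^{(d)}` is minimal at the place over an odd prime `p ∤ d` of multiplicative reduction for
the globally minimal `W`**: the model `y² = x³ + d(b₂/4)x² + d²(b₄/2)x + d³(b₆/4)` has `v`-integral
coefficients (`v(2) = v(4) = v(d) = 1`), `c₄(W^{(d)}) = d²c₄(W)` of valuation `1` (multiplicative
⇒ `v(c₄(W)) = 1` for the `v`-minimal `W`), and an integral equation with `v(c₄) = 1` is minimal.
This is the computation inside gen 1's `hasMultiplicativeReductionAtPrime_of_smul_eq_quadraticTwist`,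
exported. [cite: SilvermanAEC2009, VII.1 Remark 1.1 and X.5 Cor. 5.4 / Ex. 10.22(c)] -/
theorem isMinimalAt_quadraticTwist_of_mult (W : WeierstrassCurve ℚ) [W.IsElliptic]
    [W.IsGloballyMinimal] {d : ℤ} (v : HeightOneSpectrum (𝓞 ℚ)) (p : ℕ) [Fact p.Prime]
    (hvp : ((primesEquiv v : Nat.Primes) : ℕ) = p) (hp2 : p ≠ 2) (hpd : ¬ (p : ℤ) ∣ d)
    (hW : W.HasMultiplicativeReductionAtPrime p) :
    (W.quadraticTwist (d : ℚ)).IsMinimalAt v := by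
  subst hvp
  have hpP : ((primesEquiv v : Nat.Primes) : ℕ).Prime := (primesEquiv v).2
  have hpZ : Prime (((primesEquiv v : Nat.Primes) : ℕ) : ℤ) := Nat.prime_iff_prime_int.mp hpP
  have hp2' : ¬ (((primesEquiv v : Nat.Primes) : ℕ) : ℤ) ∣ 2 := fun h =>
    hp2 ((Nat.prime_dvd_prime_iff_eq hpP Nat.prime_two).mp (Int.natCast_dvd_natCast.mp h))
  have hp4 : ¬ (((primesEquiv v : Nat.Primes) : ℕ) : ℤ) ∣ 4 := fun h =>
    (hpZ.dvd_or_dvd (show (((primesEquiv v : Nat.Primes) : ℕ) : ℤ) ∣ 2 * 2 by norm_num; exact h)).elim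
      hp2' hp2'
  -- `W` is `v`-minimal of multiplicative type
  have hWv : W.HasMultiplicativeReductionAt v :=
    (W.hasMultiplicativeReductionAtPrime_iff_hasMultiplicativeReductionAt_ringOfIntegers v).mp hW
  have hWmin : W.IsMinimalAt v := IsGloballyMinimal.isMinimalAt W v
  obtain ⟨-, hvc₄⟩ := (hasMultiplicativeReductionAt_iff_of_isMinimalAt (W := W) (v := v) hWmin).mp hWv
  -- integrality of the coefficients of `W`
  set M : WeierstrassCurve ℤ := integralModelInt W with hM
  have hWM : M.map (Int.castRingHom ℚ) = W := map_integralModelInt W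
  have hWb₂ : W.b₂ = (M.b₂ : ℚ) := by
    rw [← congrArg WeierstrassCurve.b₂ hWM, map_b₂, eq_intCast]
  have hWb₄ : W.b₄ = (M.b₄ : ℚ) := by
    rw [← congrArg WeierstrassCurve.b₄ hWM, map_b₄, eq_intCast]
  have hWb₆ : W.b₆ = (M.b₆ : ℚ) := by
    rw [← congrArg WeierstrassCurve.b₆ hWM, map_b₆, eq_intCast]
  have hv4 : v.valuation ℚ (4 : ℚ) = 1 := by
    have h := valuation_ringOfIntegers_intCast_eq_one v (n := 4) (by exact_mod_cast hp4)
    simpa using h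
  have hv2 : v.valuation ℚ (2 : ℚ) = 1 := by
    have h := valuation_ringOfIntegers_intCast_eq_one v (n := 2) (by exact_mod_cast hp2')
    simpa using h
  have hvd : v.valuation ℚ (d : ℚ) = 1 := valuation_ringOfIntegers_intCast_eq_one v hpd
  have hvb₂ : v.valuation ℚ W.b₂ ≤ 1 := hWb₂ ▸ valuation_ringOfIntegers_intCast_le_one v _
  have hvb₄ : v.valuation ℚ W.b₄ ≤ 1 := hWb₄ ▸ valuation_ringOfIntegers_intCast_le_one v _
  have hvb₆ : v.valuation ℚ W.b₆ ≤ 1 := hWb₆ ▸ valuation_ringOfIntegers_intCast_le_one v _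
  set X : WeierstrassCurve ℚ := W.quadraticTwist (d : ℚ) with hXdef
  have hXint : X.IsIntegralAt v := by
    refine isIntegralAt_of_valuation_le_one (W := X) (v := v) ?_ ?_ ?_ ?_ ?_
    · simp [hXdef]
    · simp only [hXdef, quadraticTwist_a₂, map_div₀, map_mul, hv4, hvd, div_one, one_mul]
      exact hvb₂
    · simp [hXdef]
    · simp only [hXdef, quadraticTwist_a₄, map_div₀, map_mul, map_pow, hv2, hvd, div_one,
        one_mul, one_pow]
      exact hvb₄
    · simp only [hXdef, quadraticTwist_a₆, map_div₀, map_mul, map_pow, hv4, hvd, div_one,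
        one_mul, one_pow]
      exact hvb₆
  have hXc₄ : v.valuation ℚ X.c₄ = 1 := by
    simp only [hXdef, quadraticTwist_c₄, map_mul, map_pow, hvd, one_pow, one_mul, hvc₄]
  exact isMinimalAt_of_valuation_c₄_eq_one hXint hXc₄

/-- **Transport item (e), PROVED.** For `W/ℚ` globally minimal with multiplicative reduction at the
odd prime `p ∤ d` and ANY globally minimal model `Wd = Cd • W^{(d)}` of the twist: `ord_p u(Cd) = 0`.
[cite: SilvermanAEC2009, VII.1 Prop. 1.3(b)] [cite: JetchevSkinnerWan2017, §7.4.1 (eq:tamK)] -/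
theorem padicValRat_u_eq_zero_of_smul_quadraticTwist (W : WeierstrassCurve ℚ) [W.IsElliptic]
    [W.IsGloballyMinimal] (p : ℕ) [Fact p.Prime] (hp2 : p ≠ 2) {d : ℤ} (hd : d ≠ 0)
    (hpd : ¬ (p : ℤ) ∣ d) (hW : W.HasMultiplicativeReductionAtPrime p)
    (Wd : WeierstrassCurve ℚ) [Wd.IsElliptic] [Wd.IsGloballyMinimal] (Cd : VariableChange ℚ)
    (hWd : Cd • W.quadraticTwist (d : ℚ) = Wd) : padicValRat p (Cd.u : ℚ) = 0 := by
  have hpP : p.Prime := Fact.out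
  obtain ⟨v, hv⟩ : ∃ v : HeightOneSpectrum (𝓞 ℚ), ((primesEquiv v : ℕ)) = p :=
    ⟨primesEquiv.symm ⟨p, hpP⟩, by rw [Equiv.apply_symm_apply]⟩
  have hd0 : (d : ℚ) ≠ 0 := by exact_mod_cast hd
  haveI : (W.quadraticTwist (d : ℚ)).IsElliptic := W.isElliptic_quadraticTwist hd0
  -- the twisted equation and `Wd = Cd • (twisted equation)` are both minimal at `v`
  have hX : (W.quadraticTwist (d : ℚ)).IsMinimalAt v :=
    isMinimalAt_quadraticTwist_of_mult W v p hv hp2 hpd hW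
  have hCX : (Cd • W.quadraticTwist (d : ℚ)).IsMinimalAt v := by
    rw [hWd]; exact IsGloballyMinimal.isMinimalAt Wd v
  have h1 := valuation_u_eq_one_of_isMinimalAt_smul (W.quadraticTwist (d : ℚ)) Cd v hX hCX
  exact padicValRat_eq_zero_of_valuation_eq_one v p hv (Units.ne_zero Cd.u) h1

/-! ### The transport package from the Tamagawa value alone -/

/-- **`TwistTransportPackage` ⇐ the Tamagawa value (d) alone** (item (e) being
`padicValRat_u_eq_zero_of_smul_quadraticTwist`: on a CellC pair `p` is odd and multiplicative, and
`p ∤ d_K` because `p ∣ N` splits in the Heegner field `K`). [cite: JetchevSkinnerWan2017, §7.4.1 (eq:tamK)] -/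
theorem twistTransportPackage_of_tamagawaValue
    (htam : ∀ (W : WeierstrassCurve ℚ) [W.IsElliptic] [W.IsGloballyMinimal] (p : ℕ) [Fact p.Prime]
      (K : Type) [Field K] [NumberField K] (Wd : WeierstrassCurve ℚ) [Wd.IsElliptic]
      [Wd.IsGloballyMinimal] (Cd : VariableChange ℚ),
      CellC W p → IsImaginaryQuadratic K → Odd (NumberField.discr K) →
      SatisfiesHeegnerHypothesis (W.conductorNorm ℤ) K →
      Cd • W.quadraticTwist (NumberField.discr K : ℚ) = Wd →
      padicValNat p Wd.tamagawaProduct = padicValNat p W.tamagawaProduct) :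
    TwistTransportPackage := by
  intro W _ _ p _ K _ _ Wd _ _ Cd hc hK hodd hHN hWd
  have hp : p.Prime := Fact.out
  have hp2 : p ≠ 2 := hc.2.1
  have hmult : W.HasMultiplicativeReductionAtPrime p := hc.2.2.2
  refine ⟨htam W p K Wd Cd hc hK hodd hHN hWd, ?_⟩
  -- `p ∣ N` splits in `K`, so `p ∤ d_K`
  have hpN : p ∣ W.conductorNorm ℤ :=
    (W.dvd_conductorNorm_iff_not_hasGoodReductionAtPrime p).mpr
      (WeierstrassCurve.HasMultiplicativeReduction.not_hasGoodReduction (R := ℤ_[p]) hmult)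
  have hsplit : SatisfiesHeegnerHypothesis p K := SatisfiesHeegnerHypothesis.of_dvd hpN hHN
  have hpd : ¬ (p : ℤ) ∣ NumberField.discr K := not_dvd_discr_of_split hK hp hp2 hsplit
  exact padicValRat_u_eq_zero_of_smul_quadraticTwist W p hp2 (NumberField.discr_ne_zero K) hpd hmult
    Wd Cd hWd

end Summit.BirchSwinnertonDyer.Rank1Residual.X2

end
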